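import Summits.QuantumFields.BalabanUV.Beta.GAN24.CombBorderWordTools
import Summits.QuantumFields.BalabanUV.Beta.GAN24.CombVHEWordsZero
import Summits.QuantumFields.BalabanUV.Beta.GAN24.CombForcingSectorSplit
import Summits.QuantumFields.BalabanUV.Beta.GAN24.EEWordSwap

/-!
# `BalabanUV.Beta.GAN24.CombEEWordTransfer` — binder row G-an2-4 ∕ (CONV-C), TRANSFER-III, the (III′) (C)-campaign's supplier `hB0`, **THE `E′ ⊗ E′` WORD AT THE COMB DATA IS THE (E) WORD**
# (leaf-01 g85 `README-g85`: «`E ⊗ E` at comb = J2's twin»): **IN THE ZERO MODE, THE TWO-FACE WORD OF `X̃♮_j` WITH BOTH HALF-VERTICES OVER THE TRANSPORTED WILSON TABLE `𝒯(cE • wilsonA)`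
# EQUALS THE SAME WORD OVER THE UNTRANSPORTED TABLE** — every kernel level `j`, every transport root, all units, ALL axes; hence at level `0` it IS leaf-04's number `EEWordValue.ee_word_value`
# (`μ ≠ α`, `ν ≠ β`).  Mechanism: the outer legs drop (A1); the word reduces to `Σ'_{y₁} Σ_a j_c(a,y₁)·G(a,y₁)` with `G(a,y₁) = Σ'_z Σ_b Y y₁ z (inl a)(inl b)·t(b,z)` (the Wilson vertex is
# pure ff; leaf-04's `fubini3`); the resummed right current `t` loses its slot transport (A2 §1) and is `Lc`-periodic bounded, so in `Y = Ψ̂X̃Ψ̂ᵀ` the right `Ψ̂ᵀ` drops (F8 §3) and the left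
# `Ψ̂` acts as `Ψ_S` on the `Lc`-periodic response `G`, which it fixes (g84 F5); finally the left family loses its slot transport in the zero mode (D1 §3)
# (G-an2-4 CRUX TEAM (2), leaf prover `b2b-balaban-gan24-formalise-leaf-01`, gen 86; journal [LEAF01-G86-INTENT-4])

NOT IN PRINT; OUR BOOKKEEPING ([folklore] BY NAME over leaf-01 g86 A1 ∕ A2 ∕ B ∕ D1, g85 F8, g84 F5 `SymCorrectorZeroSymbol`, d1-leaf-03's `SymCorrectorKernel`, leaf-04's `EEWordValue` (`fubini3`,
`ee_word_value`), `ExchangeSlotResum.hasSum_slot_word`, `NoFFWordCurrentKill.exists_common_rate`, `VHWordsZeroLatticeStep.current_bounded`, an2's kernel calculus; 0 `def`, 0 cited fact,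
0 `def … : Prop`, 0 sorry).  HONEST FRAMING (cell contract, verbatim): «discharging `BetaPertH` makes Bałaban's UV stability UNCONDITIONAL — a real constructive-QFT result; it is NOT the
continuum limit and NOT the Clay problem.»  HONEST DEPENDENCY (verbatim): «continuum YM on T⁴ ⇐ BetaPertH ∧ nine spine estimates (0/9 proved); BetaPertH ⇐ (D1) ∧ (D4) ∧ CAP+tail; G-an2-4
gates asym, D1 and NE2/3/4.»

## What is proved (generic `d`)
* §1 (blocking `N`) `comp_noFM_inl_inl`, **`tsum_ffOnly_word_eq_reduced`**: for `P` bi-localised at one point WITHOUT field–multiplier block, a decaying `Y`, a right family `R_{u′}` bi-localised at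
  `N•u′` without `(inr ·, g)` rows, weights `|ρ₁|,|ρ₂| ≤ 1` and a bounded `t` with `Σ'_{(u′,w)} ρ₂(w)·R_{u′} z w (inl b) g = t b z`:
  `Σ'_{u′} Σ'_{(y,w)} ρ₁ρ₂·((P∘Y)∘R_{u′}) y w (inl α′) g = Σ'_{y₁} Σ_a (Σ'_y ρ₁(y)·P y y₁ (inl α′)(inl a))·(Σ'_z Σ_b Y y₁ z (inl a)(inl b)·t b z)` (leaf-04's EE outer Fubini with the tables abstracted).
* §2 (`Ψ̂ = psiKS r n`) **`tsum_sum_sandwich_inl_inl_mul_periodic`**: for a decaying `X`, a bounded `n`-periodic current `t` and an `n`-periodic response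
  `G κ y := Σ'_z Σ_b X y z (inl κ)(inl b)·t b z`, `Σ'_z Σ_b (Ψ̂XΨ̂ᵀ) y₁ z (inl a)(inl b)·t b z = G a y₁` (the FIELD-row twin of F8 §3b).
* §3 (`[NeZero Lc]`, in-block kernel root, every `j`) `dressedResponse_periodic` (the response `G` of `X̃♮_j` to a periodic current is periodic).
* §4 **`sum_box_transported_ee_word_eq`** (every `j`, any transport root `r ∈ box`, all units, any `cE`, ALL axes):
  `Σ_{c∈box Lc} Σ'_{u′} FF[(vertexOfK X̃♮_j Lc (unitS (𝒯W)) μ c ∘ X̃♮_j) ∘ vertexOfK X̃♮_j Lc (unitS (𝒯W)) ν u′] = Σ_{c∈box Lc} Σ'_{u′} FF[(vertexOfK X̃♮_j Lc (unitS W) μ c ∘ X̃♮_j) ∘ vertexOfK X̃♮_j Lc (unitS W) ν u′]`,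
  `W = cE • wilsonA`; **`sum_box_comb_ee_word_eq_value`** (the comb root, level `0`, EVERY axis pattern): the comb `E′ ⊗ E′` zero-mode word IS leaf-04's number `EEWordSwap.ee_word_value'` at the root `ctrOff`.
WHAT THIS IS NOT: NOT `hB0 0` (the pair-form assembly of ALL level-0 words — leaf-06 g55's (E) text at the comb data — is the next file); levels `≥ 1` untouched; NEVER «G-an2-4 closed» as (CONV-C);
NOT D1, NOT `BetaPertH`, NOT continuum, NOT Clay.  2026-08-27; no existing file touched.
-/

noncomputable section

open Finset
open scoped BigOperators
open Literature.MathematicalPhysics.QuantumFieldTheory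
open Literature.MathematicalPhysics.QuantumFieldTheory.Balaban1983to89
open Literature.MathematicalPhysics.QuantumFieldTheory.Balaban1983to89.Beta
open B12Sec2to5 (l1)
open ExpKernelCalculus (Site MKer comp shiftK Decays BiLoc VertexFamily)
open BalabanStepJetsSucc (biLoc_comp_right decays_comp)
open AxialDressing (summable_row_of_decays)
open AffineAveraging (box toSite)
open AveragingContoursRooted (ctr ctrOff ctrOff_mem_box)
open OneStepResolventKernel (Fib LocStencil decays_mono biLoc_mono)
open OneStepKernelFamily (KInvStep vertexOfK vertexFamily_vertexOfK decays_KInvStep)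
open StepJetData (wilsonA locStencil_wilsonA locStencil_smul)
open Summit.QuantumFields.BalabanUV.Beta.TameKernelCalculus (trK trK_apply decays_trK Spr)
open Summit.QuantumFields.BalabanUV.Beta.AxialDressingRooted (coDressKBmAt decays_coDressKBmAt)
open Summit.QuantumFields.BalabanUV.Beta.HessKerDressedUnits (unitK unitS decays_unitK locStencil_unitS)
open Summit.QuantumFields.BalabanUV.Beta.CompositeCorrectorKernel (indR)
open Summit.QuantumFields.BalabanUV.Beta.SymCorrectorForms (corrPsiS)
open Summit.QuantumFields.BalabanUV.Beta.SymCorrectorKernel (psiKS spr_psiKS decays_psiKS comp_psiKS_inl corrPsiS_apply_eq_sum exists_finset_corrReadsS)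
open Summit.QuantumFields.BalabanUV.Beta.SymCorrectorFace (slotPsiS)
open Summit.QuantumFields.BalabanUV.Beta.SymCorrectorSockets (locStencil_slotPsiS)
open Summit.QuantumFields.BalabanUV.Beta.GAN24.SymCorrectorZeroSymbol (corrPsiS_eq_self_of_periodic)
open Summit.QuantumFields.BalabanUV.Beta.GAN24.CombSlotResumTransport (vertexOfK_unitS_transport_eq_conj tsum_weight_mul_comp_trK_psiKS_right summable_weight_mul')
open Summit.QuantumFields.BalabanUV.Beta.GAN24.ExchangeSlotResum (hasSum_slot_word face_weight_periodic)
open Summit.QuantumFields.BalabanUV.Beta.GAN24.ExchangeFieldLegs (vertexOfK_wilson_inl_inr vertexOfK_wilson_inr_inl)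
open Summit.QuantumFields.BalabanUV.Beta.GAN24.NoFFWordCurrentKill (exists_common_rate)
open Summit.QuantumFields.BalabanUV.Beta.GAN24.EEWordValue (fubini3)
open Summit.QuantumFields.BalabanUV.Beta.GAN24.EEWordSwap (ee_word_value')
open Summit.QuantumFields.BalabanUV.Beta.GAN24.EEWordReduced (shiftK_dressedStep)
open Summit.QuantumFields.BalabanUV.Beta.GAN24.VHWordsZeroLatticeStep (current_bounded)
open Summit.QuantumFields.BalabanUV.Beta.GAN24.CombTransportedBorder (pos_Lc)
open Summit.QuantumFields.BalabanUV.Beta.GAN24.CombForcingSectorSplit (E_zero_translate)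
open Summit.QuantumFields.BalabanUV.Beta.GAN24.TransportedWordTools (exists_decays_sandwich tsum_twoFace_conj_word_eq vertexOfK_unitS_slotPsiS_entry_eq_zero)
open Summit.QuantumFields.BalabanUV.Beta.GAN24.TransportedWordReduction (tsum_prod_weight_vertexOfK_dressedStep_slotPsiS)
open Summit.QuantumFields.BalabanUV.Beta.GAN24.CombVHEWordsZero (wilsonCurrent_periodic wilson_inr_inl)
open Summit.QuantumFields.BalabanUV.Beta.GAN24.CombBorderWordTools (sum_box_leftFamily_slotPsiS_eq)

namespace Summit.QuantumFields.BalabanUV.Beta.GAN24.CombEEWordTransfer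

variable {d : ℕ}

/-! ## §1 The reduced form of a two-face word whose left factor is pure on field middle legs -/

section Reduced

variable {N : ℕ} [NeZero N] {P Y : MKer (d + 1) (Fib d)} {p : Site (d + 1)} {CP δP CY δY CR δR : ℝ} {R : Site (d + 1) → MKer (d + 1) (Fib d)}

omit [NeZero N] in
/-- [folklore] The ff entries of `P ∘ Y` run through FIELD middle legs only when `P` has no field–multiplier block. -/
theorem comp_noFM_inl_inl (hPfm : ∀ (y z : Site (d + 1)) (α' m : Fin (d + 1)), P y z (Sum.inl α') (Sum.inr m) = 0) (Y : MKer (d + 1) (Fib d)) (y z : Site (d + 1)) (α' b : Fin (d + 1)) :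
    comp P Y y z (Sum.inl α') (Sum.inl b) = ∑' y₁ : Site (d + 1), ∑ a : Fin (d + 1), P y y₁ (Sum.inl α') (Sum.inl a) * Y y₁ z (Sum.inl a) (Sum.inl b) := by
  simp only [comp, Fintype.sum_sum_type, hPfm, zero_mul, Finset.sum_const_zero, add_zero]

/-- NOT IN PRINT; OUR BOOKKEEPING ([folklore]; leaf-04's `EEWordValue.ee_word_outer_fubini` with the Wilson tables abstracted).  For `P` bi-localised at `(p,p)` without field–multiplier block, a
decaying `Y`, `R_{u′}` bi-localised at `N•u′` without `(inr ·, g)` rows, weights bounded by `1`, and a bounded `t` with `Σ'_{(u′,w)} ρ₂(w)·R_{u′} z w (inl b) g = t b z`: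
`Σ'_{u′} Σ'_{(y,w)} ρ₁(y)ρ₂(w)·((P ∘ Y) ∘ R_{u′}) y w (inl α′) g = Σ'_{y₁} Σ_a (Σ'_y ρ₁(y)·P y y₁ (inl α′)(inl a))·(Σ'_z Σ_b Y y₁ z (inl a)(inl b)·t b z)`. -/
theorem tsum_ffOnly_word_eq_reduced (hP : BiLoc P p p CP δP) (hδP : 0 < δP)
    (hPfm : ∀ (y z : Site (d + 1)) (α' m : Fin (d + 1)), P y z (Sum.inl α') (Sum.inr m) = 0)
    (hY : Decays Y CY δY) (hδY : 0 < δY) (hR : ∀ u', BiLoc (R u') ((N : ℤ) • u') ((N : ℤ) • u') CR δR) (hδR : 0 < δR)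
    {g : Fib d} (hRmf : ∀ (u' z w : Site (d + 1)) (m : Fin (d + 1)), R u' z w (Sum.inr m) g = 0)
    {ρ₁ ρ₂ : Site (d + 1) → ℝ} (h₁ : ∀ y, |ρ₁ y| ≤ 1) (h₂ : ∀ w, |ρ₂ w| ≤ 1)
    {t : Fin (d + 1) → Site (d + 1) → ℝ} {M : ℝ} (ht : ∀ (b : Fin (d + 1)) (z : Site (d + 1)), ∑' uw : Site (d + 1) × Site (d + 1), ρ₂ uw.2 * R uw.1 z uw.2 (Sum.inl b) g = t b z)
    (htb : ∀ b z, |t b z| ≤ M) (α' : Fin (d + 1)) :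
    ∑' u' : Site (d + 1), ∑' yw : Site (d + 1) × Site (d + 1), ρ₁ yw.1 * ρ₂ yw.2 * comp (comp P Y) (R u') yw.1 yw.2 (Sum.inl α') g =
      ∑' y₁ : Site (d + 1), ∑ a : Fin (d + 1), (∑' y : Site (d + 1), ρ₁ y * P y y₁ (Sum.inl α') (Sum.inl a)) *
        (∑' z : Site (d + 1), ∑ b : Fin (d + 1), Y y₁ z (Sum.inl a) (Sum.inl b) * t b z) := by
  classical
  obtain ⟨δ, CA, hδ, hCA, hYd, hRd, hA, hPδ⟩ := exists_common_rate (N := N) hP hδP hY hδY hR hδR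
  have hM : 0 ≤ M := (abs_nonneg _).trans (htb 0 0)
  -- step 1: resum the slot
  rw [(hasSum_slot_word (N := N) (A := comp P Y) (Q := R) hδ hA hRd h₁ h₂ (Sum.inl α') g).tsum_eq, Fintype.sum_sum_type]
  -- step 2: multiplier middle legs carry nothing
  have hinr : ∀ m : Fin (d + 1), (∑' yz : Site (d + 1) × Site (d + 1), ρ₁ yz.1 * comp P Y yz.1 yz.2 (Sum.inl α') (Sum.inr m) *
      ∑' uw : Site (d + 1) × Site (d + 1), ρ₂ uw.2 * R uw.1 yz.2 uw.2 (Sum.inr m) g) = 0 := by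
    intro m
    simp only [hRmf, mul_zero, tsum_zero]
  simp only [hinr, Finset.sum_const_zero, add_zero]
  -- step 3: field middle legs carry the current; the ff entries of `P ∘ Y` pass through field legs
  simp only [ht, comp_noFM_inl_inl hPfm]
  -- step 4: regroup
  exact fubini3 (ι := Fin (d + 1)) (f := ρ₁) (V := fun y y₁ a => P y y₁ (Sum.inl α') (Sum.inl a)) (X := fun y₁ z a b => Y y₁ z (Sum.inl a) (Sum.inl b)) (T := t)
    (c := p) hδ (hP.nonneg (Sum.inl 0)) (hY.nonneg (Sum.inl 0)) hM h₁ (fun y y₁ a => hPδ y y₁ (Sum.inl α') (Sum.inl a))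
    (fun y₁ z a b => hYd y₁ z (Sum.inl a) (Sum.inl b)) htb

end Reduced

/-! ## §2 The field rows of the sandwich against a periodic current -/

section Sandwich

variable {n : ℕ} (hn : 0 < n) {r : Fin (d + 1) → ℕ} (hr : r ∈ box (d + 1) n)
include hn hr

/-- NOT IN PRINT; OUR BOOKKEEPING ([folklore]; the FIELD-row twin of leaf-01 g85 F8 §3b).  For a decaying `X`, a bounded `n`-periodic current `t`, and its response
`G κ y := Σ'_z Σ_b X y z (inl κ)(inl b)·t b z` assumed `n`-periodic in `y`:  `Σ'_z Σ_b (Ψ̂XΨ̂ᵀ) y₁ z (inl a)(inl b)·t b z = G a y₁` — the right `Ψ̂ᵀ` drops against the periodic `t`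
(F8 §3 `tsum_weight_mul_comp_trK_psiKS_right`), the left `Ψ̂` acts on the column family as `Ψ_S` (`comp_psiKS_inl`), a FINITE combination of its reads (`corrPsiS_apply_eq_sum`) — under which the
`z`-series regroup into `Ψ_S G`, and `Ψ_S` fixes the periodic `G` (g84 F5 `corrPsiS_eq_self_of_periodic`). -/
theorem tsum_sum_sandwich_inl_inl_mul_periodic {X : MKer (d + 1) (Fib d)} {C δ : ℝ} (hX : Decays X C δ) (hδ : 0 < δ)
    {t : Fin (d + 1) → Site (d + 1) → ℝ} {B : ℝ} (ht : ∀ b z, |t b z| ≤ B) (htper : ∀ (b : Fin (d + 1)) (z s : Site (d + 1)), t b (z + (n : ℤ) • s) = t b z)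
    (hG : ∀ (κ : Fin (d + 1)) (y s : Site (d + 1)), (∑' z : Site (d + 1), ∑ b : Fin (d + 1), X (y + (n : ℤ) • s) z (Sum.inl κ) (Sum.inl b) * t b z)
      = ∑' z : Site (d + 1), ∑ b : Fin (d + 1), X y z (Sum.inl κ) (Sum.inl b) * t b z) (y₁ : Site (d + 1)) (a : Fin (d + 1)) :
    ∑' z : Site (d + 1), ∑ b : Fin (d + 1), comp (comp (psiKS r n) X) (trK (psiKS r n)) y₁ z (Sum.inl a) (Sum.inl b) * t b z
      = ∑' z : Site (d + 1), ∑ b : Fin (d + 1), X y₁ z (Sum.inl a) (Sum.inl b) * t b z := by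
  classical
  -- (i) the right `Ψ̂ᵀ` drops, row by row
  have hΨX : Decays (comp (psiKS r n) X) _ (δ / 2) := decays_comp (decays_psiKS hn hr hδ.le) hX (show (0 : ℝ) ≤ δ / 2 by positivity) (by linarith)
  have hΨXT : Decays (comp (comp (psiKS r n) X) (trK (psiKS r n))) _ (δ / 4) :=
    decays_comp hΨX (decays_trK (decays_psiKS hn hr (show (0 : ℝ) ≤ δ / 2 by positivity))) (show (0 : ℝ) ≤ δ / 4 by positivity) (by linarith)
  have hs1 : ∀ b : Fin (d + 1), Summable fun z => comp (comp (psiKS r n) X) (trK (psiKS r n)) y₁ z (Sum.inl a) (Sum.inl b) * t b z := fun b =>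
    summable_weight_mul' (ht b) (summable_row_of_decays hΨXT (by positivity) y₁ (Sum.inl a) (Sum.inl b))
  have hs2 : ∀ b : Fin (d + 1), Summable fun z => comp (psiKS r n) X y₁ z (Sum.inl a) (Sum.inl b) * t b z := fun b =>
    summable_weight_mul' (ht b) (summable_row_of_decays hΨX (by positivity) y₁ (Sum.inl a) (Sum.inl b))
  have step1 : ∑' z : Site (d + 1), ∑ b : Fin (d + 1), comp (comp (psiKS r n) X) (trK (psiKS r n)) y₁ z (Sum.inl a) (Sum.inl b) * t b z
      = ∑' z : Site (d + 1), ∑ b : Fin (d + 1), comp (psiKS r n) X y₁ z (Sum.inl a) (Sum.inl b) * t b z := by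
    rw [Summable.tsum_finsetSum (fun b _ => hs1 b), Summable.tsum_finsetSum (fun b _ => hs2 b)]
    refine Finset.sum_congr rfl fun b _ => ?_
    have c1 : ∀ (K : MKer (d + 1) (Fib d)) (z : Site (d + 1)), K y₁ z (Sum.inl a) (Sum.inl b) * t b z = t b z * K y₁ z (Sum.inl a) (Sum.inl b) := fun K z => mul_comm _ _
    simp only [c1]
    exact tsum_weight_mul_comp_trK_psiKS_right hn hr (comp (psiKS r n) X) y₁ (Sum.inl a) (Sum.inl b)
      (fun b' => summable_row_of_decays hΨX (by positivity) y₁ (Sum.inl a) b') (ht b) (htper b)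
  rw [step1]
  -- (ii) the left `Ψ̂` as a finite combination of reads of the column family
  obtain ⟨S, hS⟩ := exists_finset_corrReadsS (d := d) hn a y₁
  have e : ∀ (z : Site (d + 1)) (b : Fin (d + 1)), comp (psiKS r n) X y₁ z (Sum.inl a) (Sum.inl b)
      = ∑ q ∈ S, corrPsiS (toSite r) n (indR q.1 q.2) a y₁ * X q.2 z (Sum.inl q.1) (Sum.inl b) := by
    intro z b
    rw [comp_psiKS_inl hn hr X y₁ z a (Sum.inl b)]
    exact corrPsiS_apply_eq_sum hn hr a y₁ hS _
  have e2 : ∀ z : Site (d + 1), ∑ b : Fin (d + 1), comp (psiKS r n) X y₁ z (Sum.inl a) (Sum.inl b) * t b z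
      = ∑ q ∈ S, corrPsiS (toSite r) n (indR q.1 q.2) a y₁ * ∑ b : Fin (d + 1), X q.2 z (Sum.inl q.1) (Sum.inl b) * t b z := by
    intro z
    simp only [e, Finset.sum_mul, Finset.mul_sum]
    rw [Finset.sum_comm]
    exact Finset.sum_congr rfl fun q _ => Finset.sum_congr rfl fun b _ => by ring
  rw [tsum_congr e2]
  have hs3 : ∀ q ∈ S, Summable fun z => corrPsiS (toSite r) n (indR q.1 q.2) a y₁ * ∑ b : Fin (d + 1), X q.2 z (Sum.inl q.1) (Sum.inl b) * t b z := fun q _ =>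
    (summable_sum fun b _ => summable_weight_mul' (ht b) (summable_row_of_decays hX hδ q.2 (Sum.inl q.1) (Sum.inl b))).mul_left _
  rw [Summable.tsum_finsetSum hs3]
  simp only [tsum_mul_left]
  -- (iii) the finite combination is `Ψ_S G`, and `Ψ_S` fixes the periodic `G`
  rw [← corrPsiS_apply_eq_sum hn hr a y₁ hS (fun κ y => ∑' z : Site (d + 1), ∑ b : Fin (d + 1), X y z (Sum.inl κ) (Sum.inl b) * t b z),
    corrPsiS_eq_self_of_periodic (n := n) (toSite r) (fun κ y s => hG κ y s)]

end Sandwich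

/-! ## §3 The response of the dressed step kernel to a periodic current is periodic -/

section Response

variable {Lc : ℕ} [NeZero Lc] {rb : Fin (d + 1) → ℕ}

/-- [folklore] For every `j`, all units and any current `t` with `t b (z + Lc•s) = t b z`, the response `y ↦ Σ'_z Σ_b X̃♮_j y z (inl κ)(inl b)·t b z` is `Lc`-periodic (block-translation invariance
of the dressed step kernel, leaf-04's `EEWordReduced.shiftK_dressedStep`; reindex `z ↦ z + Lc•s`). -/
theorem dressedResponse_periodic (hLc : 1 ≤ Lc) (sf sm : ℝ) (j : ℕ) {t : Fin (d + 1) → Site (d + 1) → ℝ}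
    (htper : ∀ (b : Fin (d + 1)) (z s : Site (d + 1)), t b (z + (Lc : ℤ) • s) = t b z) (κ : Fin (d + 1)) (y s : Site (d + 1)) :
    (∑' z : Site (d + 1), ∑ b : Fin (d + 1), unitK sf sm (coDressKBmAt (toSite rb) Lc (KInvStep (d := d) Lc j)) (y + (Lc : ℤ) • s) z (Sum.inl κ) (Sum.inl b) * t b z)
      = ∑' z : Site (d + 1), ∑ b : Fin (d + 1), unitK sf sm (coDressKBmAt (toSite rb) Lc (KInvStep (d := d) Lc j)) y z (Sum.inl κ) (Sum.inl b) * t b z := by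
  have hK := shiftK_dressedStep (r := rb) hLc sf sm j s
  have h : ∀ (z : Site (d + 1)) (b : Fin (d + 1)), unitK sf sm (coDressKBmAt (toSite rb) Lc (KInvStep (d := d) Lc j)) y z (Sum.inl κ) (Sum.inl b)
      = unitK sf sm (coDressKBmAt (toSite rb) Lc (KInvStep (d := d) Lc j)) (y + (Lc : ℤ) • s) (z + (Lc : ℤ) • s) (Sum.inl κ) (Sum.inl b) := by
    intro z b
    have h1 := congrFun (congrFun (congrFun (congrFun hK (y + (Lc : ℤ) • s)) (z + (Lc : ℤ) • s)) (Sum.inl κ)) (Sum.inl b)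
    simp only [shiftK, add_neg_cancel_right] at h1
    exact h1
  calc (∑' z : Site (d + 1), ∑ b : Fin (d + 1), unitK sf sm (coDressKBmAt (toSite rb) Lc (KInvStep (d := d) Lc j)) (y + (Lc : ℤ) • s) z (Sum.inl κ) (Sum.inl b) * t b z)
      = ∑' z : Site (d + 1), ∑ b : Fin (d + 1), unitK sf sm (coDressKBmAt (toSite rb) Lc (KInvStep (d := d) Lc j)) (y + (Lc : ℤ) • s) (z + (Lc : ℤ) • s) (Sum.inl κ) (Sum.inl b) * t b (z + (Lc : ℤ) • s) :=
        ((Equiv.addRight ((Lc : ℤ) • s)).tsum_eq (fun z : Site (d + 1) => ∑ b : Fin (d + 1),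
          unitK sf sm (coDressKBmAt (toSite rb) Lc (KInvStep (d := d) Lc j)) (y + (Lc : ℤ) • s) z (Sum.inl κ) (Sum.inl b) * t b z)).symm
    _ = ∑' z : Site (d + 1), ∑ b : Fin (d + 1), unitK sf sm (coDressKBmAt (toSite rb) Lc (KInvStep (d := d) Lc j)) y z (Sum.inl κ) (Sum.inl b) * t b z :=
        tsum_congr fun z => Finset.sum_congr rfl fun b _ => by rw [htper b z s, ← h z b]

end Response

/-! ## §4 The EE word over transported Wilson tables is the EE word -/

section Transfer

variable {Lc : ℕ} [NeZero Lc] {rb r : Fin (d + 1) → ℕ} {μ ν α β : Fin (d + 1)}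

/-- NOT IN PRINT; OUR BOOKKEEPING ([folklore]; `E′ ⊗ E′` AT THE COMB DATA = `E ⊗ E`).  For every kernel level `j`, in-block kernel root `toSite rb`, ANY transport root `r ∈ box`, `1 ≤ Lc`, all units,
any `cE`, ALL axes, in the zero mode over the cell `box Lc`:
`Σ_{c∈box Lc} Σ'_{u′} FF[(vertexOfK X̃♮_j Lc (unitS (𝒯W)) μ c ∘ X̃♮_j) ∘ vertexOfK X̃♮_j Lc (unitS (𝒯W)) ν u′] = Σ_{c∈box Lc} Σ'_{u′} FF[(vertexOfK X̃♮_j Lc (unitS W) μ c ∘ X̃♮_j) ∘ vertexOfK X̃♮_j Lc (unitS W) ν u′]`,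
`W = cE • wilsonA`.  ROUTE: both sides to the reduced form `Σ_c Σ'_{y₁} Σ_a j_c(a,y₁)·G(a,y₁)` (§1; on the left after A1's outer-leg drop, with the slot-transported tables, the sandwich and — by
A2 §1 — the SAME untransported current `t`); the sandwich response is the bare response `G` (§2 with §3); the left family loses its slot transport in the zero mode (D1 §3, `G` periodic by §3 and
bounded by periodicity). -/
theorem sum_box_transported_ee_word_eq (hLc : 1 ≤ Lc) (hrb : rb ∈ box (d + 1) Lc) (hr : r ∈ box (d + 1) Lc) (sf sm cE : ℝ) (j : ℕ) :
    ∑ c ∈ box (d + 1) Lc, ∑' u' : Site (d + 1), ∑' yw : Site (d + 1) × Site (d + 1), (if yw.1 α % (Lc : ℤ) = (Lc : ℤ) - 1 then (1 : ℝ) else 0) * (if yw.2 β % (Lc : ℤ) = (Lc : ℤ) - 1 then (1 : ℝ) else 0) *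
        comp (comp (vertexOfK (unitK sf sm (coDressKBmAt (toSite rb) Lc (KInvStep (d := d) Lc j))) Lc
            (unitS sf sm (fun κ u => comp (comp (trK (psiKS r Lc)) (slotPsiS r Lc (fun κ v => cE • wilsonA d κ v) κ u)) (psiKS r Lc))) μ (toSite c))
          (unitK sf sm (coDressKBmAt (toSite rb) Lc (KInvStep (d := d) Lc j))))
          (vertexOfK (unitK sf sm (coDressKBmAt (toSite rb) Lc (KInvStep (d := d) Lc j))) Lc
            (unitS sf sm (fun κ u => comp (comp (trK (psiKS r Lc)) (slotPsiS r Lc (fun κ v => cE • wilsonA d κ v) κ u)) (psiKS r Lc))) ν u') yw.1 yw.2 (Sum.inl α) (Sum.inl β) =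
      ∑ c ∈ box (d + 1) Lc, ∑' u' : Site (d + 1), ∑' yw : Site (d + 1) × Site (d + 1), (if yw.1 α % (Lc : ℤ) = (Lc : ℤ) - 1 then (1 : ℝ) else 0) * (if yw.2 β % (Lc : ℤ) = (Lc : ℤ) - 1 then (1 : ℝ) else 0) *
        comp (comp (vertexOfK (unitK sf sm (coDressKBmAt (toSite rb) Lc (KInvStep (d := d) Lc j))) Lc (unitS sf sm (fun κ v => cE • wilsonA d κ v)) μ (toSite c))
          (unitK sf sm (coDressKBmAt (toSite rb) Lc (KInvStep (d := d) Lc j))))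
          (vertexOfK (unitK sf sm (coDressKBmAt (toSite rb) Lc (KInvStep (d := d) Lc j))) Lc (unitS sf sm (fun κ v => cE • wilsonA d κ v)) ν u') yw.1 yw.2 (Sum.inl α) (Sum.inl β) := by
  classical
  have hLc0 : 0 < Lc := hLc
  set X := unitK sf sm (coDressKBmAt (toSite rb) Lc (KInvStep (d := d) Lc j)) with hX
  -- the untransported product-form current and its response
  set t : Fin (d + 1) → Site (d + 1) → ℝ := fun b z => ∑' uw : Site (d + 1) × Site (d + 1), (if uw.2 β % (Lc : ℤ) = (Lc : ℤ) - 1 then (1 : ℝ) else 0) *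
    vertexOfK X Lc (unitS sf sm (fun κ v => cE • wilsonA d κ v)) ν uw.1 z uw.2 (Sum.inl b) (Sum.inl β) with htdef
  have hper : ∀ (b : Fin (d + 1)) (z s : Site (d + 1)), t b (z + (Lc : ℤ) • s) = t b z := fun b z s => by
    simp only [htdef, hX]
    exact wilsonCurrent_periodic (rb := rb) hLc sf sm cE j ν β (Sum.inl b) (Sum.inl β) z s
  have htb := fun b z => current_bounded (Lc := Lc) hper b z
  set G : Fin (d + 1) → Site (d + 1) → ℝ := fun κ y => ∑' z : Site (d + 1), ∑ b : Fin (d + 1), X y z (Sum.inl κ) (Sum.inl b) * t b z with hGdef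
  have hGper : ∀ (κ : Fin (d + 1)) (y s : Site (d + 1)), G κ (y + (Lc : ℤ) • s) = G κ y := fun κ y s => by
    simp only [hGdef, hX]
    exact dressedResponse_periodic (rb := rb) hLc sf sm j hper κ y s
  have hGb := fun κ y => current_bounded (Lc := Lc) hGper κ y
  -- common-rate data
  obtain ⟨δK, CK, hδK, hCK, hXd⟩ := decays_coDressKBmAt hLc hrb (decays_KInvStep (d := d) (Lc := Lc) j)
  have hXu : Decays X (max |sf| |sm| * CK * max |sf| |sm|) δK := decays_unitK (sf := sf) (sm := sm) hXd
  have hCX : 0 ≤ max |sf| |sm| * CK * max |sf| |sm| := by positivity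
  have hXspr : Spr X := ⟨_, _, hδK, hXu⟩
  have hW1 := locStencil_smul cE (locStencil_wilsonA (d := d) hδK.le)
  have hWs := locStencil_slotPsiS (d := d) hLc0 r hW1 hδK.le
  have hV := vertexFamily_vertexOfK (N := Lc) hXu hCX (locStencil_unitS (sf := sf) (sm := sm) hW1) hδK le_rfl
  have hVs := vertexFamily_vertexOfK (N := Lc) hXu hCX (locStencil_unitS (sf := sf) (sm := sm) hWs) hδK le_rfl
  have h₁ : ∀ y : Site (d + 1), |(if y α % (Lc : ℤ) = (Lc : ℤ) - 1 then (1 : ℝ) else 0)| ≤ 1 := fun y => by split_ifs <;> simp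
  have h₂ : ∀ w : Site (d + 1), |(if w β % (Lc : ℤ) = (Lc : ℤ) - 1 then (1 : ℝ) else 0)| ≤ 1 := fun w => by split_ifs <;> simp
  have hWfm : ∀ (κ : Fin (d + 1)) (t' x z : Site (d + 1)) (α' m : Fin (d + 1)), (cE • wilsonA d κ t') x z (Sum.inl α') (Sum.inr m) = 0 := by
    intro κ t' x z α' m
    simp only [Pi.smul_apply, smul_eq_mul]
    rw [show wilsonA d κ t' x z (Sum.inl α') (Sum.inr m) = 0 from rfl, mul_zero]
  obtain ⟨CY, hCY, hY⟩ := exists_decays_sandwich hLc0 hr hXu hδK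
  -- LEFT side, per cell bond: outer legs drop, then the reduced form with the sandwich
  have hL : ∀ c : Site (d + 1), (∑' u' : Site (d + 1), ∑' yw : Site (d + 1) × Site (d + 1), (if yw.1 α % (Lc : ℤ) = (Lc : ℤ) - 1 then (1 : ℝ) else 0) * (if yw.2 β % (Lc : ℤ) = (Lc : ℤ) - 1 then (1 : ℝ) else 0) *
        comp (comp (vertexOfK X Lc (unitS sf sm (fun κ u => comp (comp (trK (psiKS r Lc)) (slotPsiS r Lc (fun κ v => cE • wilsonA d κ v) κ u)) (psiKS r Lc))) μ c) X)
          (vertexOfK X Lc (unitS sf sm (fun κ u => comp (comp (trK (psiKS r Lc)) (slotPsiS r Lc (fun κ v => cE • wilsonA d κ v) κ u)) (psiKS r Lc))) ν u') yw.1 yw.2 (Sum.inl α) (Sum.inl β))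
      = ∑' y₁ : Site (d + 1), ∑ a : Fin (d + 1), (∑' y : Site (d + 1), (if y α % (Lc : ℤ) = (Lc : ℤ) - 1 then (1 : ℝ) else 0) *
          vertexOfK X Lc (unitS sf sm (slotPsiS r Lc (fun κ v => cE • wilsonA d κ v))) μ c y y₁ (Sum.inl α) (Sum.inl a)) * G a y₁ := by
    intro c
    have e : ∀ u' : Site (d + 1), (∑' yw : Site (d + 1) × Site (d + 1), (if yw.1 α % (Lc : ℤ) = (Lc : ℤ) - 1 then (1 : ℝ) else 0) * (if yw.2 β % (Lc : ℤ) = (Lc : ℤ) - 1 then (1 : ℝ) else 0) *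
          comp (comp (vertexOfK X Lc (unitS sf sm (fun κ u => comp (comp (trK (psiKS r Lc)) (slotPsiS r Lc (fun κ v => cE • wilsonA d κ v) κ u)) (psiKS r Lc))) μ c) X)
            (vertexOfK X Lc (unitS sf sm (fun κ u => comp (comp (trK (psiKS r Lc)) (slotPsiS r Lc (fun κ v => cE • wilsonA d κ v) κ u)) (psiKS r Lc))) ν u') yw.1 yw.2 (Sum.inl α) (Sum.inl β)) =
        ∑' yw : Site (d + 1) × Site (d + 1), (if yw.1 α % (Lc : ℤ) = (Lc : ℤ) - 1 then (1 : ℝ) else 0) * (if yw.2 β % (Lc : ℤ) = (Lc : ℤ) - 1 then (1 : ℝ) else 0) *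
          comp (comp (vertexOfK X Lc (unitS sf sm (slotPsiS r Lc (fun κ v => cE • wilsonA d κ v))) μ c) (comp (comp (psiKS r Lc) X) (trK (psiKS r Lc))))
            (vertexOfK X Lc (unitS sf sm (slotPsiS r Lc (fun κ v => cE • wilsonA d κ v))) ν u') yw.1 yw.2 (Sum.inl α) (Sum.inl β) := by
      intro u'
      rw [vertexOfK_unitS_transport_eq_conj hLc0 hr hXspr sf sm hW1 hδK μ c, vertexOfK_unitS_transport_eq_conj hLc0 hr hXspr sf sm hW1 hδK ν u']
      exact tsum_twoFace_conj_word_eq hLc0 hr (hVs μ c) (half_pos hδK) (hVs ν u') (half_pos hδK) hXu hδK h₁ (fun y s => face_weight_periodic Lc α y s) h₂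
        (fun w s => face_weight_periodic Lc β w s) _ _
    rw [tsum_congr e]
    rw [tsum_ffOnly_word_eq_reduced (N := Lc) (hVs μ c) (half_pos hδK)
      (fun y z α' m => vertexOfK_unitS_slotPsiS_entry_eq_zero r X Lc sf sm (fun κ t' x z' => hWfm κ t' x z' α' m) μ c y z) hY (by positivity) (fun u' => hVs ν u') (half_pos hδK)
      (fun u' z w m => vertexOfK_unitS_slotPsiS_entry_eq_zero r X Lc sf sm (fun κ t' x z' => wilson_inr_inl cE β κ t' x z' m) ν u' z w) h₁ h₂ (t := t)
      (fun b z => by rw [htdef, hX]; exact tsum_prod_weight_vertexOfK_dressedStep_slotPsiS hLc hrb sf sm j ν r hW1 hδK h₂ z (Sum.inl b) (Sum.inl β)) htb α]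
    refine tsum_congr fun y₁ => Finset.sum_congr rfl fun a _ => ?_
    congr 1
    rw [hGdef]
    exact tsum_sum_sandwich_inl_inl_mul_periodic hLc0 hr hXu hδK htb hper (fun κ y s => hGper κ y s) y₁ a
  -- RIGHT side, per cell bond: the reduced form with the bare kernel
  have hR : ∀ c : Site (d + 1), (∑' u' : Site (d + 1), ∑' yw : Site (d + 1) × Site (d + 1), (if yw.1 α % (Lc : ℤ) = (Lc : ℤ) - 1 then (1 : ℝ) else 0) * (if yw.2 β % (Lc : ℤ) = (Lc : ℤ) - 1 then (1 : ℝ) else 0) *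
        comp (comp (vertexOfK X Lc (unitS sf sm (fun κ v => cE • wilsonA d κ v)) μ c) X) (vertexOfK X Lc (unitS sf sm (fun κ v => cE • wilsonA d κ v)) ν u') yw.1 yw.2 (Sum.inl α) (Sum.inl β))
      = ∑' y₁ : Site (d + 1), ∑ a : Fin (d + 1), (∑' y : Site (d + 1), (if y α % (Lc : ℤ) = (Lc : ℤ) - 1 then (1 : ℝ) else 0) *
          vertexOfK X Lc (unitS sf sm (fun κ v => cE • wilsonA d κ v)) μ c y y₁ (Sum.inl α) (Sum.inl a)) * G a y₁ := by
    intro c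
    rw [tsum_ffOnly_word_eq_reduced (N := Lc) (hV μ c) (half_pos hδK) (fun y z α' m => vertexOfK_wilson_inl_inr X Lc sf sm cE μ c y z α' m)
      hXu hδK (fun u' => hV ν u') (half_pos hδK) (fun u' z w m => vertexOfK_wilson_inr_inl X Lc sf sm cE ν u' z w m β)
      h₁ h₂ (t := t) (fun b z => by rw [htdef]) htb α]
  rw [Finset.sum_congr rfl fun c _ => hL (toSite c), Finset.sum_congr rfl fun c _ => hR (toSite c), hX]
  -- the cell sum: the left family loses its slot transport
  exact sum_box_leftFamily_slotPsiS_eq (μ := μ) (γ := α) hLc hrb sf sm j r (locStencil_smul cE (locStencil_wilsonA (d := d) zero_le_one)) one_pos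
    (fun κ u t' => E_zero_translate (Lc := Lc) cE κ u t') hGb hGper

/-- NOT IN PRINT; OUR BOOKKEEPING ([folklore]; THE `E′ ⊗ E′` VALUE AT THE COMB DATA, LEVEL `0`, EVERY AXIS PATTERN).  At the comb root `ρ_c = ctr (d+1) Lc` (`= toSite (ctrOff (d+1) Lc)`,
`rfl`), transport `𝒯 = Ψ̂_Sᵀ∘slotPsiS (ctrOff) Lc∘Ψ̂_S`, all units, any `cE`, ALL axes: the comb `E′ ⊗ E′` zero-mode word at level `0` IS leaf-04's number —
`Σ_{c∈box Lc} Σ'_{u′} FF[(vertexOfK X̃_0 Lc (unitS (𝒯(cE•wilsonA))) μ c ∘ X̃_0) ∘ vertexOfK X̃_0 Lc (unitS (𝒯(cE•wilsonA))) ν u′] = −K₁²·s_f²·E·½·Lc^{d−1}·(Lc^{d+1} − Lc^{d−1})`,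
`E = [μ=ν][α=β] − [μ=β][α=ν]` (`EEWordSwap.ee_word_value'` at the root `ctrOff (d+1) Lc`, after `sum_box_transported_ee_word_eq`). -/
theorem sum_box_comb_ee_word_eq_value (sf sm cE : ℝ) :
    ∑ c ∈ box (d + 1) Lc, ∑' u' : Site (d + 1), ∑' yw : Site (d + 1) × Site (d + 1), (if yw.1 α % (Lc : ℤ) = (Lc : ℤ) - 1 then (1 : ℝ) else 0) * (if yw.2 β % (Lc : ℤ) = (Lc : ℤ) - 1 then (1 : ℝ) else 0) *
        comp (comp (vertexOfK (unitK sf sm (coDressKBmAt (ctr (d + 1) Lc) Lc (KInvStep (d := d) Lc 0))) Lc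
            (unitS sf sm (fun κ v => comp (comp (trK (psiKS (ctrOff (d + 1) Lc) Lc)) (slotPsiS (ctrOff (d + 1) Lc) Lc (fun κ v => cE • wilsonA d κ v) κ v)) (psiKS (ctrOff (d + 1) Lc) Lc))) μ (toSite c))
          (unitK sf sm (coDressKBmAt (ctr (d + 1) Lc) Lc (KInvStep (d := d) Lc 0))))
          (vertexOfK (unitK sf sm (coDressKBmAt (ctr (d + 1) Lc) Lc (KInvStep (d := d) Lc 0))) Lc
            (unitS sf sm (fun κ v => comp (comp (trK (psiKS (ctrOff (d + 1) Lc) Lc)) (slotPsiS (ctrOff (d + 1) Lc) Lc (fun κ v => cE • wilsonA d κ v) κ v)) (psiKS (ctrOff (d + 1) Lc) Lc))) ν u')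
          yw.1 yw.2 (Sum.inl α) (Sum.inl β) =
      -(((((Lc : ℝ) * (sm * sf)) * ((((Lc ^ (0 + 1) : ℕ) : ℝ)) ^ (d + 1 + 1))⁻¹) * ((sf * sm)⁻¹ * (sf⁻¹ * sf⁻¹) * cE))) ^ 2 * (sf * sf) *
        (((if μ = ν ∧ α = β then (1 : ℝ) else 0) - (if μ = β ∧ α = ν then (1 : ℝ) else 0)) * ((1 / 2 : ℝ) * (Lc : ℝ) ^ (d - 1) * ((Lc : ℝ) ^ (d + 1) - (Lc : ℝ) ^ (d - 1)))) := by
  have hLc : 1 ≤ Lc := Nat.one_le_iff_ne_zero.mpr (NeZero.ne Lc)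
  exact (sum_box_transported_ee_word_eq (μ := μ) (ν := ν) (α := α) (β := β) hLc (ctrOff_mem_box (pos_Lc (Lc := Lc))) (ctrOff_mem_box (pos_Lc (Lc := Lc))) sf sm cE 0).trans
    (ee_word_value' hLc (ctrOff_mem_box (pos_Lc (Lc := Lc))) sf sm cE)

end Transfer

end Summit.QuantumFields.BalabanUV.Beta.GAN24.CombEEWordTransfer

end
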